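import Mathlib
import Summits.Ventures.HodgeRepro.Tier4.Line4.HorbChain
import Summits.Ventures.HodgeRepro.Tier4.Line4.FiniteSum

/-!
# Tier4/Line4/HorbMain — C-L4-MAINTERM, the two kernel lemmas: the chain as an IDENTITY, and the quantitative FINSUM

Blind re-derivation cell `pub-hodge-repro`, Tier 4 «prove the step» (README §9–§10), seat t4-L2-p1 (gen 3; L4 service
prover; taken S15030 on plan-4 g4's (T) ruling S14998 «(S4) `hmain` = L4's chain + `arch_ne`»).  Tree path
`lean/Summits/Ventures/HodgeRepro/Tier4/Line4/HorbMain.lean`.  Imports `Line4/HorbChain` (p698645: CONV-Z, UNFOLD-Z,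
ZDOMAIN, PRODINT, FINSUM by name) and `Line4/FiniteSum` (p697806).  Mathlib-level; no literature.

WHY.  The TAIL assembly (`Setting.exists_J_ne_zero_of_support_count`, TailAssemblySupport p700783) asks for the MAIN TERM
`hmain : ∃ m > 0, ∃ N₁, ∀ N ≥ N₁, m ≤ ‖S.orbital χ χ' o₀ (f N)‖`, UNIFORM in the level, while the chain as landed
(`horb_of_chain` / `horb_of_integ` / `horb_of_integ_definite`) gives `≠ 0` for one test function.  The gap is the SIZE of
the finite factor, not its sign.  Two kernel lemmas close it in the chain's own vocabulary, so that the level family may be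
whatever `TailFamily` fixes:

* **`orbital_eq_mul_of_chain`** — `horb_of_chain`'s binders MINUS the FINSUM inputs and `harch`, and its proof exported as
  the IDENTITY `orbital (orbitOf γ₀) F = (c c′) · (∫_{T_∞} χ(a) I_∞(a) dν_∞) · (∫_{DZ_f} χ(b) I_f(b) dν_f)`
  (CONV-Z ∘ UNFOLD-Z ∘ ZDOMAIN ∘ PRODINT); so `‖orbital‖ = c c′ ‖arch‖ ‖fin‖`.
* **`re_setIntegral_chi_innerFin_ge`** — the QUANTITATIVE FINSUM: with `F_f` real non-negative and
  `Re (χ(b) conj χ′(b′)) ≥ δ` wherever `F_f(b⁻¹ γ₀,f b′) ≠ 0` (`b ∈ DZ_f`),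
  `δ · ∫_{DZ_f × T′_f} Re F_f(b⁻¹ γ₀,f b′) ≤ Re ∫_{DZ_f} χ(b) I_f(b) dν_f` (Fubini exactly as in FINSUM; the real part of
  the integrand is `Re(χ conj χ′) · Re F_f ≥ δ · Re F_f` on the support).  For an indicator `F_f = 1_A` the left side is
  `δ · (ν_f ⊗ ν′_f)({(b, b′) ∈ DZ_f × T′_f : b⁻¹ γ₀,f b′ ∈ A})`.
* **`norm_orbital_ge_of_chain`** — the two combined: `c c′ ‖arch‖ · δ · ∫_{DZ_f × T′_f} Re F_f ≤ ‖orbital (orbitOf γ₀) F‖`.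

The level-family application — `m := c c′ ‖arch‖ δ · (the measure of the support region)/(the `fin` normalisation)`,
uniform in `N` once `TailFamily.fin` normalises by the level volume and ZDOMAIN-EX (iii) (`DZ_f ⊇ U ∋ 1`) puts
`(K(N) ∩ T_f) × (K(N) ∩ T′_f)` inside the support region for deep `N` — is the (7b)/(8′) owners' to state on these names.

Nothing here says anything about the status of the Hodge conjecture for CM abelian varieties, which is NOT proved
(HC_CM is NOT proved by anyone in this repository).
-/

set_option autoImplicit false
noncomputable section
namespace Summit.Ventures.HodgeRepro.Tier4.Line4
open Summit.Ventures.HodgeRepro.Tier4 Summit.Ventures.HodgeRepro.Tier4.Common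
  Summit.Ventures.HodgeRepro.Tier4.Line1 MeasureTheory
open scoped ComplexConjugate Topology Pointwise NNReal

/-! ## (1) The chain as an identity -/

section Identity
variable {k : Type} [Field k] [NumberField k] (W : PlaneData k) [MeasurableSpace (GA W)] [BorelSpace (GA W)]
  (R : RTFData W) (μ : Measure (GA W)) [μ.IsHaarMeasure] [R.μT.IsHaarMeasure] [R.μT'.IsHaarMeasure]
  (DG : Set (GA W)) (fdG : IsFundamentalDomain (rationalPoints W) DG μ) (compG : IsCompact (closure DG))
  (compT : IsCompact (closure R.DT)) (compT' : IsCompact (closure R.DT'))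

/-- **The chain as an identity**: for a product test function `F = F_∞ ⊗ F_f`, a regular rational `γ₀`, product Haar
normalisations on both tori, a fundamental domain `DZ_f` of the image of `Z(k)` in `T_f` and the displayed
integrability / summability inputs of CONV-Z, UNFOLD-Z and PRODINT, the setting's orbital term at `orbitOf γ₀` IS
`(c c′) · (∫_{T_∞} χ I_∞) · (∫_{DZ_f} χ I_f)`.  (`horb_of_chain`'s binders without `hreal hnonneg hpos hint hsupp harch`.) -/
theorem orbital_eq_mul_of_chain [MeasurableMul (torusT W)] [MeasurableMul (torusT' W)] (hR : R.IsHaar)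
    (F Finf Ffin : GA W → ℂ) (hF : ∀ g, F g = Finf (GA.ofInfPart W g) * Ffin (GA.ofFinPart W g))
    (γ₀ : rationalPoints W) (hreg : IsRegularRational W γ₀)
    (νinf : Measure (torusInf W)) [νinf.IsHaarMeasure] (νf : Measure (torusFin W)) [νf.IsHaarMeasure]
    (c : ℝ≥0) (hc : R.μT = c • Measure.map (torusSplit W).symm (νinf.prod νf))
    (νinf' : Measure (torusInf' W)) [νinf'.IsHaarMeasure] (νf' : Measure (torusFin' W)) [νf'.IsHaarMeasure]
    (c' : ℝ≥0) (hc' : R.μT' = c' • Measure.map (torusSplit' W).symm (νinf'.prod νf'))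
    (DZf : Set (torusFin W)) (hDZf : MeasurableSet DZf) (hfd : IsFundamentalDomain (centreFin W) DZf νf)
    -- CONV-Z (A1)–(A4)
    (hA1 : ∀ (γ : rationalPoints W) (t : torusT W),
      Integrable (innerFn W R F (γ : GA W) t) (R.μT'.restrict R.DT'))
    (hA2 : ∀ t : torusT W, Summable (fun γ : Set.range (orbitMap W γ₀) =>
      ∫ t' in R.DT', ‖innerFn W R F ((γ : rationalPoints W) : GA W) t t'‖ ∂(R.μT')))
    (hA3 : ∀ γ : rationalPoints W,
      Integrable (fun t : torusT W => R.chi t * innerInt W R F (γ : GA W) t) (R.μT.restrict R.DT))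
    (hA4 : Summable (fun γ : Set.range (orbitMap W γ₀) =>
      ∫ t in R.DT, ‖R.chi t * innerInt W R F ((γ : rationalPoints W) : GA W) t‖ ∂(R.μT)))
    -- UNFOLD-Z (B1)–(B4) + the orbit sum summable
    (hs : Summable (fun γ : Set.range (orbitMap W γ₀) => R.orbitalc ((γ : rationalPoints W) : GA W) F))
    (hB1 : IntegrableOn (fun t : torusT W => R.chi t * innerFull W R F (γ₀ : GA W) t) (prodDomain W DZf) R.μT)
    (hB2 : ∀ s : torusT W, Integrable (innerFn W R F (γ₀ : GA W) s) R.μT')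
    (hB3 : ∀ (δ : rationalOf W (torusT W)) (δ' : rationalOf W (torusT' W)),
      Integrable (fun t : torusT W =>
        R.chi t * innerInt W R F (((δ : torusT W) : GA W)⁻¹ * (γ₀ : GA W) * ((δ' : torusT' W) : GA W)) t)
        (R.μT.restrict R.DT))
    (hB4 : ∀ δ : rationalOf W (torusT W), Summable (fun δ' : rationalOf W (torusT' W) =>
      ∫ t in R.DT, ‖R.chi t * innerInt W R F (((δ : torusT W) : GA W)⁻¹ * (γ₀ : GA W) * ((δ' : torusT' W) : GA W)) t‖
        ∂(R.μT)))
    -- PRODINT integrability displays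
    (hA : ∀ t : torusT W, Integrable (fun a : torusInf' W => conj (R.chi' (a : torusT' W)) *
      Finf ((GA.ofInfPart W t)⁻¹ * GA.ofInfPart W (γ₀ : GA W) * ((a : torusT' W) : GA W))) νinf')
    (hB : ∀ t : torusT W, Integrable (fun b : torusFin' W => conj (R.chi' (b : torusT' W)) *
      Ffin ((GA.ofFinPart W t)⁻¹ * GA.ofFinPart W (γ₀ : GA W) * ((b : torusT' W) : GA W))) νf')
    (hIinf : Integrable (fun a : torusInf W => R.chi a * innerInf W R Finf (γ₀ : GA W) νinf' a) νinf)
    (hIfin : IntegrableOn (fun b : torusFin W => R.chi b * innerFin W R Ffin (γ₀ : GA W) νf' b) DZf νf) :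
    (Setting.ofAdelicData W R μ DG fdG compG compT compT').orbital R.chi R.chi'
      ((Setting.ofAdelicData W R μ DG fdG compG compT compT').orbitOf γ₀) F =
      ((c : ℂ) * (c' : ℂ)) * (∫ a : torusInf W, R.chi a * innerInf W R Finf (γ₀ : GA W) νinf' a ∂νinf) *
        (∫ b in DZf, R.chi b * innerFin W R Ffin (γ₀ : GA W) νf' b ∂νf) := by
  rw [orbital_eq_tsum_orbitalc W R μ DG fdG compG compT compT' F γ₀ hA1 hA2 hA3 hA4,
    tsum_orbit_eq_setIntegral_innerFull_of_regular W R hR F γ₀ hreg (prodDomain W DZf)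
      (isFundamentalDomain_prodDomain W νinf νf R.μT c hc DZf hfd) hs hB1 hB2 hB3 hB4,
    setIntegral_chi_innerFull_prodDomain_eq W R νinf νf c hc νinf' νf' c' hc' F Finf Ffin hF (γ₀ : GA W) DZf hDZf
      hA hB hIinf hIfin]

end Identity

/-! ## (2) The quantitative FINSUM -/

section FinLower
variable {k : Type} [Field k] [NumberField k] (W : PlaneData k)
  [MeasurableSpace (torusT W)] [MeasurableSpace (torusT' W)] (R : RTFData W)

/-- **The quantitative FINSUM**: for a real non-negative `F_f` with `Re (χ(b) conj χ′(b′)) ≥ δ` wherever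
`F_f(b⁻¹ γ₀,f b′) ≠ 0` (`b ∈ DZ_f`), `δ · ∫_{DZ_f × T′_f} Re F_f(b⁻¹ γ₀,f b′) ≤ Re ∫_{DZ_f} χ(b) I_f(b) dν_f`
(Fubini on `DZ_f × T′_f` as in FINSUM; the real part of the integrand is `Re(χ conj χ′) · Re F_f ≥ δ · Re F_f` on the
support).  The characters are continuous of modulus one (so that the integrability of the `χ conj χ′ F_f` integrand,
`hint` = INTEG (D), gives that of `F_f` alone). -/
theorem re_setIntegral_chi_innerFin_ge [BorelSpace (torusT W)] [BorelSpace (torusT' W)]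
    (hc : Continuous R.chi) (hu : ∀ a, ‖R.chi a‖ = 1) (hc' : Continuous R.chi') (hu' : ∀ a, ‖R.chi' a‖ = 1)
    (νf : Measure (torusFin W)) [νf.IsHaarMeasure] (νf' : Measure (torusFin' W)) [νf'.IsHaarMeasure]
    (Ffin : GA W → ℂ) (hreal : ∀ g, (Ffin g).im = 0) (hnonneg : ∀ g, 0 ≤ (Ffin g).re)
    (γ₀ : GA W) (DZf : Set (torusFin W)) (hDZf : MeasurableSet DZf) (δ : ℝ)
    (hδ : ∀ b ∈ DZf, ∀ b' : torusFin' W,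
      Ffin ((((b : torusT W) : GA W))⁻¹ * GA.ofFinPart W γ₀ * ((b' : torusT' W) : GA W)) ≠ 0 →
      δ ≤ (R.chi b * conj (R.chi' b')).re)
    (hint : IntegrableOn (fun p : torusFin W × torusFin' W => R.chi p.1 * conj (R.chi' p.2) *
      Ffin ((((p.1 : torusT W) : GA W))⁻¹ * GA.ofFinPart W γ₀ * ((p.2 : torusT' W) : GA W)))
      (DZf ×ˢ Set.univ) (νf.prod νf')) :
    δ * ∫ p in DZf ×ˢ Set.univ,
        (Ffin ((((p.1 : torusT W) : GA W))⁻¹ * GA.ofFinPart W γ₀ * ((p.2 : torusT' W) : GA W))).re ∂(νf.prod νf') ≤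
      (∫ b in DZf, R.chi b * innerFin W R Ffin γ₀ νf' b ∂νf).re := by
  haveI := locallyCompact_GA W
  haveI := secondCountable_GA W
  haveI := locallyCompactSpace_torusT W
  haveI := locallyCompactSpace_torusT' W
  haveI : SecondCountableTopology (torusT W) :=
    TopologicalSpace.Subtype.secondCountableTopology (torusT W : Set (GA W))
  haveI : SecondCountableTopology (torusT' W) :=
    TopologicalSpace.Subtype.secondCountableTopology (torusT' W : Set (GA W))
  haveI : SecondCountableTopology (torusFin W) :=
    TopologicalSpace.Subtype.secondCountableTopology (torusFin W : Set (torusT W))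
  haveI : SecondCountableTopology (torusFin' W) :=
    TopologicalSpace.Subtype.secondCountableTopology (torusFin' W : Set (torusT' W))
  haveI : LocallyCompactSpace (torusFin W) := (isClosed_torusFin W).locallyCompactSpace
  haveI : LocallyCompactSpace (torusFin' W) := (isClosed_torusFin' W).locallyCompactSpace
  haveI : IsLocallyFiniteMeasure νf := isLocallyFiniteMeasure_of_isFiniteMeasureOnCompacts
  haveI : IsLocallyFiniteMeasure νf' := isLocallyFiniteMeasure_of_isFiniteMeasureOnCompacts
  haveI : SigmaFinite νf := sigmaFinite_of_locallyFinite
  haveI : SigmaFinite νf' := sigmaFinite_of_locallyFinite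
  haveI : BorelSpace (torusFin W) := Subtype.borelSpace _
  haveI : BorelSpace (torusFin' W) := Subtype.borelSpace _
  -- the integrand on `DZ_f × T′_f` and the product measure
  set Fo : torusFin W × torusFin' W → ℂ := fun p =>
    Ffin ((((p.1 : torusT W) : GA W))⁻¹ * GA.ofFinPart W γ₀ * ((p.2 : torusT' W) : GA W)) with hFo
  set g : torusFin W × torusFin' W → ℂ := fun p => R.chi p.1 * conj (R.chi' p.2) * Fo p with hg
  set μ : Measure (torusFin W × torusFin' W) := (νf.restrict DZf).prod νf' with hμ
  have hμ' : μ = (νf.prod νf').restrict (DZf ×ˢ Set.univ) := Measure.restrict_prod_eq_prod_univ DZf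
  have hgint : Integrable g μ := by rw [hμ']; exact hint
  -- `F_f ∘ orbit` is integrable too: `Fo = (conj χ ⊗ χ′) · g` with a bounded continuous factor
  have hFoint : Integrable Fo μ := by
    have hbd : Integrable (fun p : torusFin W × torusFin' W => (conj (R.chi p.1) * R.chi' p.2) * g p) μ := by
      refine hgint.bdd_mul (c := 1) ?_ (Filter.Eventually.of_forall fun p => ?_)
      · refine Continuous.aestronglyMeasurable ?_
        exact (Complex.continuous_conj.comp (hc.comp (continuous_subtype_val.comp continuous_fst))).mul
          (hc'.comp (continuous_subtype_val.comp continuous_snd))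
      · rw [norm_mul, Complex.norm_conj, hu, hu', one_mul]
    refine hbd.congr (Filter.Eventually.of_forall fun p => ?_)
    show conj (R.chi p.1) * R.chi' p.2 * (R.chi p.1 * conj (R.chi' p.2) * Fo p) = Fo p
    have h1 : conj (R.chi p.1) * R.chi p.1 = 1 := by
      rw [Complex.conj_mul', hu]; norm_num
    have h2 : R.chi' p.2 * conj (R.chi' p.2) = 1 := by
      rw [mul_comm, Complex.conj_mul', hu']; norm_num
    calc conj (R.chi p.1) * R.chi' p.2 * (R.chi p.1 * conj (R.chi' p.2) * Fo p)
        = (conj (R.chi p.1) * R.chi p.1) * (R.chi' p.2 * conj (R.chi' p.2)) * Fo p := by ring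
      _ = Fo p := by rw [h1, h2, one_mul, one_mul]
  -- (A)+(B): the set integral of `χ · I_f` is the integral of `g` over `DZ_f × T′_f` (Fubini)
  have hEq : ∫ b in DZf, R.chi b * innerFin W R Ffin γ₀ νf' b ∂νf = ∫ p, g p ∂μ := by
    rw [hμ, integral_prod g hgint]
    refine integral_congr_ae (Filter.Eventually.of_forall fun b => ?_)
    simp only [innerFin, hg, hFo]
    rw [← integral_const_mul]
    refine integral_congr_ae (Filter.Eventually.of_forall fun b' => ?_)
    ring
  -- (C): the real part passes inside
  have hRe : (∫ p, g p ∂μ).re = ∫ p, (g p).re ∂μ := by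
    have h := integral_re hgint
    simpa only [RCLike.re_to_complex] using h.symm
  -- a.e. on `μ` the first coordinate lies in `DZ_f`
  have hae : ∀ᵐ p ∂μ, p.1 ∈ DZf := by
    rw [hμ']
    filter_upwards [ae_restrict_mem (hDZf.prod MeasurableSet.univ)] with p hp
    exact hp.1
  -- the real part of `g` is `Re(χ conj χ′) · Re F_f`
  have hre_g : ∀ p : torusFin W × torusFin' W, (g p).re = (R.chi p.1 * conj (R.chi' p.2)).re * (Fo p).re :=
    fun p => re_mul_of_im_eq_zero _ _ (hreal _)
  -- the pointwise lower bound a.e.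
  have hle : (fun p => δ * (Fo p).re) ≤ᵐ[μ] fun p => (g p).re := by
    filter_upwards [hae] with p hp
    show δ * (Fo p).re ≤ (g p).re
    rw [hre_g]
    by_cases h0 : Fo p = 0
    · rw [h0, Complex.zero_re, mul_zero, mul_zero]
    · exact mul_le_mul_of_nonneg_right (hδ p.1 hp p.2 h0) (hnonneg _)
  rw [hEq, hRe, ← hμ', ← integral_const_mul]
  exact integral_mono_ae (hFoint.re.const_mul δ) hgint.re hle

end FinLower

/-! ## (3) The two combined: a lower bound for the orbital term -/

section Combined
variable {k : Type} [Field k] [NumberField k] (W : PlaneData k) [MeasurableSpace (GA W)] [BorelSpace (GA W)]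
  (R : RTFData W) (μ : Measure (GA W)) [μ.IsHaarMeasure] [R.μT.IsHaarMeasure] [R.μT'.IsHaarMeasure]
  (DG : Set (GA W)) (fdG : IsFundamentalDomain (rationalPoints W) DG μ) (compG : IsCompact (closure DG))
  (compT : IsCompact (closure R.DT)) (compT' : IsCompact (closure R.DT'))

/-- **The lower bound for the orbital term**: `c c′ ‖∫_{T_∞} χ I_∞‖ · δ · ∫_{DZ_f × T′_f} Re F_f ≤ ‖orbital (orbitOf γ₀) F‖`
— `orbital_eq_mul_of_chain` and `re_setIntegral_chi_innerFin_ge` combined (`‖z‖ ≥ Re z`).  The main-term input `hmain`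
of the TAIL assembly is this bound on the level family, with `m := c c′ ‖arch‖ δ · (the measure of the support region)`
uniform in the level under the `fin` normalisation. -/
theorem norm_orbital_ge_of_chain [MeasurableMul (torusT W)] [MeasurableMul (torusT' W)] (hR : R.IsHaar)
    (hc : Continuous R.chi) (hu : ∀ a, ‖R.chi a‖ = 1) (hc' : Continuous R.chi') (hu' : ∀ a, ‖R.chi' a‖ = 1)
    (F Finf Ffin : GA W → ℂ) (hF : ∀ g, F g = Finf (GA.ofInfPart W g) * Ffin (GA.ofFinPart W g))
    (γ₀ : rationalPoints W) (hreg : IsRegularRational W γ₀)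
    (νinf : Measure (torusInf W)) [νinf.IsHaarMeasure] (νf : Measure (torusFin W)) [νf.IsHaarMeasure]
    (c : ℝ≥0) (hcμ : R.μT = c • Measure.map (torusSplit W).symm (νinf.prod νf))
    (νinf' : Measure (torusInf' W)) [νinf'.IsHaarMeasure] (νf' : Measure (torusFin' W)) [νf'.IsHaarMeasure]
    (c' : ℝ≥0) (hcμ' : R.μT' = c' • Measure.map (torusSplit' W).symm (νinf'.prod νf'))
    (DZf : Set (torusFin W)) (hDZf : MeasurableSet DZf) (hfd : IsFundamentalDomain (centreFin W) DZf νf)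
    -- CONV-Z (A1)–(A4)
    (hA1 : ∀ (γ : rationalPoints W) (t : torusT W),
      Integrable (innerFn W R F (γ : GA W) t) (R.μT'.restrict R.DT'))
    (hA2 : ∀ t : torusT W, Summable (fun γ : Set.range (orbitMap W γ₀) =>
      ∫ t' in R.DT', ‖innerFn W R F ((γ : rationalPoints W) : GA W) t t'‖ ∂(R.μT')))
    (hA3 : ∀ γ : rationalPoints W,
      Integrable (fun t : torusT W => R.chi t * innerInt W R F (γ : GA W) t) (R.μT.restrict R.DT))
    (hA4 : Summable (fun γ : Set.range (orbitMap W γ₀) =>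
      ∫ t in R.DT, ‖R.chi t * innerInt W R F ((γ : rationalPoints W) : GA W) t‖ ∂(R.μT)))
    -- UNFOLD-Z (B1)–(B4) + the orbit sum summable
    (hs : Summable (fun γ : Set.range (orbitMap W γ₀) => R.orbitalc ((γ : rationalPoints W) : GA W) F))
    (hB1 : IntegrableOn (fun t : torusT W => R.chi t * innerFull W R F (γ₀ : GA W) t) (prodDomain W DZf) R.μT)
    (hB2 : ∀ s : torusT W, Integrable (innerFn W R F (γ₀ : GA W) s) R.μT')
    (hB3 : ∀ (δ : rationalOf W (torusT W)) (δ' : rationalOf W (torusT' W)),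
      Integrable (fun t : torusT W =>
        R.chi t * innerInt W R F (((δ : torusT W) : GA W)⁻¹ * (γ₀ : GA W) * ((δ' : torusT' W) : GA W)) t)
        (R.μT.restrict R.DT))
    (hB4 : ∀ δ : rationalOf W (torusT W), Summable (fun δ' : rationalOf W (torusT' W) =>
      ∫ t in R.DT, ‖R.chi t * innerInt W R F (((δ : torusT W) : GA W)⁻¹ * (γ₀ : GA W) * ((δ' : torusT' W) : GA W)) t‖
        ∂(R.μT)))
    -- PRODINT integrability displays
    (hA : ∀ t : torusT W, Integrable (fun a : torusInf' W => conj (R.chi' (a : torusT' W)) *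
      Finf ((GA.ofInfPart W t)⁻¹ * GA.ofInfPart W (γ₀ : GA W) * ((a : torusT' W) : GA W))) νinf')
    (hB : ∀ t : torusT W, Integrable (fun b : torusFin' W => conj (R.chi' (b : torusT' W)) *
      Ffin ((GA.ofFinPart W t)⁻¹ * GA.ofFinPart W (γ₀ : GA W) * ((b : torusT' W) : GA W))) νf')
    (hIinf : Integrable (fun a : torusInf W => R.chi a * innerInf W R Finf (γ₀ : GA W) νinf' a) νinf)
    (hIfin : IntegrableOn (fun b : torusFin W => R.chi b * innerFin W R Ffin (γ₀ : GA W) νf' b) DZf νf)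
    -- the quantitative FINSUM inputs
    (hreal : ∀ g, (Ffin g).im = 0) (hnonneg : ∀ g, 0 ≤ (Ffin g).re) (δ : ℝ)
    (hδ : ∀ b ∈ DZf, ∀ b' : torusFin' W,
      Ffin ((((b : torusT W) : GA W))⁻¹ * GA.ofFinPart W (γ₀ : GA W) * ((b' : torusT' W) : GA W)) ≠ 0 →
      δ ≤ (R.chi b * conj (R.chi' b')).re)
    (hint : IntegrableOn (fun p : torusFin W × torusFin' W => R.chi p.1 * conj (R.chi' p.2) *
      Ffin ((((p.1 : torusT W) : GA W))⁻¹ * GA.ofFinPart W (γ₀ : GA W) * ((p.2 : torusT' W) : GA W)))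
      (DZf ×ˢ Set.univ) (νf.prod νf')) :
    (c : ℝ) * (c' : ℝ) * ‖∫ a : torusInf W, R.chi a * innerInf W R Finf (γ₀ : GA W) νinf' a ∂νinf‖ *
        (δ * ∫ p in DZf ×ˢ Set.univ,
          (Ffin ((((p.1 : torusT W) : GA W))⁻¹ * GA.ofFinPart W (γ₀ : GA W) * ((p.2 : torusT' W) : GA W))).re
          ∂(νf.prod νf')) ≤
      ‖(Setting.ofAdelicData W R μ DG fdG compG compT compT').orbital R.chi R.chi'
        ((Setting.ofAdelicData W R μ DG fdG compG compT compT').orbitOf γ₀) F‖ := by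
  haveI : BorelSpace (torusT W) := Subtype.borelSpace _
  haveI : BorelSpace (torusT' W) := Subtype.borelSpace _
  rw [orbital_eq_mul_of_chain W R μ DG fdG compG compT compT' hR F Finf Ffin hF γ₀ hreg νinf νf c hcμ νinf' νf' c'
    hcμ' DZf hDZf hfd hA1 hA2 hA3 hA4 hs hB1 hB2 hB3 hB4 hA hB hIinf hIfin]
  have hfin := re_setIntegral_chi_innerFin_ge W R hc hu hc' hu' νf νf' Ffin hreal hnonneg (γ₀ : GA W) DZf hDZf δ hδ
    hint
  have hre := Complex.re_le_norm (∫ b in DZf, R.chi b * innerFin W R Ffin (γ₀ : GA W) νf' b ∂νf)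
  have hcc : ‖((c : ℂ) * (c' : ℂ))‖ = (c : ℝ) * (c' : ℝ) := by
    rw [norm_mul]
    simp only [Complex.norm_real, Real.norm_eq_abs, NNReal.abs_eq]
  rw [norm_mul, norm_mul, hcc]
  have h0 : 0 ≤ (c : ℝ) * (c' : ℝ) * ‖∫ a : torusInf W, R.chi a * innerInf W R Finf (γ₀ : GA W) νinf' a ∂νinf‖ :=
    mul_nonneg (mul_nonneg c.2 c'.2) (norm_nonneg _)
  exact mul_le_mul_of_nonneg_left (hfin.trans hre) h0

end Combined

end Summit.Ventures.HodgeRepro.Tier4.Line4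

end
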